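import Literature.Computability.AlgebraicComplexity.IK2020GammaProdMatrixCoefficient
import Literature.Computability.AlgebraicComplexity.IK2020WeylModuleOrbitSeparation
import Literature.Computability.AlgebraicComplexity.IK2020OrbitFunctionSpan
import Literature.Computability.AlgebraicComplexity.IK2020PowerSumInvariantsDecompositionProofs
import Literature.Computability.AlgebraicComplexity.IK2020OrbitFunctionsFact
import Literature.Computability.AlgebraicComplexity.IK2020Thm42OfOrbitFunctions
import Literature.Computability.AlgebraicComplexity.IK2020Lemma52OfThm42
import HarnessLib

/-!
# Ikenmeyer–Kandasamy 2020, Thm. 9.1 ∘ Prop. 10.1 — DISCHARGE of the cite-fact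
# `IK2020_thm_9_1_orbitFunctions` (brick M4 of the cell's programme #4)

Typed-and-proved literature (cell `val-lit`, row IK20-A; honest framing: bookkeeping of
Ikenmeyer–Kandasamy's toy model `p = x₁^D + ⋯ + x_m^D`; VP ≠ VNP is NOT proved and nothing here is
progress on it). This file proves `IK2020_thm_9_1_orbitFunctions_holds : IK2020_thm_9_1_orbitFunctions`
(the named fact of `IK2020OrbitFunctionsFact.lean`, = the first two sentences of the printed proof of
IK 2020 Thm. 4.2, TeX L1147–1154: "By Theorem 9.1 and Proposition 10.1 … there exists a set of
regular tableaux `S_{ϱ,i}`, `ϱ ∈ Ξ`, `1 ≤ i ≤ b(λ,ϱ,D,d)`, of shape `λ` … content `Dϱ` … the functions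
`gp ↦ γ(g P_m S_{ϱ,i})` … restrictions to `SL_m p` are linearly independent"), and with it — through
the assembly `IK2020_thm_4_2_of_orbitFunctions` (`IK2020Thm42OfOrbitFunctions.lean`) and
`IK2020_lemma_5_2_of_thm_4_2` — IK's Main Technical Theorem 4.2 and Lemma 5.2 become theorems of
the tree (§4: `IK2020_thm_4_2_holds`, `IK2020_lemma_5_2_holds`).

Route (architect's note `HOME/bip/NOTE-t02g6-G-discharge-sizing.md`, val-lit-t02; lead-bip
RULINGS #12/#12a/#13): NOT the printed Peter–Weyl route (Thm. 9.2 / (9.3)) but the "𝔖_n-side"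
matrix-coefficient reading of the orbit functions inside `(ℂ^m)^{⊗n}`, every input a tree theorem:

* M1 (`IK2020GammaProdMatrixCoefficient.lean`): `⟨e_r, g · c_λ e_x⟩ = |R_λ| · γ(g T_x)`;
* M2 (`IK2020WeylModuleOrbitSeparation.lean`): `h ∈ {λ}`, `⟨e_r, s · h⟩ = 0` for all `s ∈ SL_m`
  `⇒ h = 0` (irreducibility of `{λ}` + homogeneity);
* M3 (`IK2020OrbitFunctionSpan.lean`): `span {h_x | content(x) ∈ 𝔖_m·(D·ϱ)} = ({λ}_ϱ)^{𝔖_m}`,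
  `h_x = ∑_π P_π c_λ e_x`, of dimension `b(λ,ϱ,D,d)` (`IK2020_prop_10_1_holds`);
* the direct sum over `ϱ` (`IK2020.contentSubspace_independent`,
  `IK2020PowerSumInvariantsDecompositionProofs.lean`, IK §9 TeX L813–814).

Assembly (this file): for each `ϱ ∈ Ξ` pick `b(λ,ϱ,D,d)` words `x_{ϱ,i}` of content exactly `D·ϱ`
(normalising inside the class by `symYoung_comp_perm`) whose symmetrised Young tensors `h_{x_{ϱ,i}}`
are linearly independent (`exists_linearIndependent` in the `b`-dimensional span); they are
column-strict (`h_x ≠ 0`, `young_tensorBasis_eq_zero_of_not_isColStrict`), so the tableaux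
`S_{ϱ,i} = T_{x_{ϱ,i}}` (`IK2020.wordTableau`, `IK2020TableauWords.lean`) are regular of shape `λ` and
content `D·ϱ`; the `h`'s are jointly independent over `Σ ϱ : Ξ, Fin b` (direct sum over `ϱ`); and
`s ↦ ⟨e_r, s · h_x⟩ = |R_λ| ∑_π γ(s, T_{π∘x}) = |R_λ| f^{S_x}(s)` (M1), so a linear relation among the
orbit functions on `SL_m` is a vector of `{λ}` killed by all `⟨e_r, s · –⟩`, hence zero (M2), hence
trivial.

## References

* [IkenmeyerKandasamy2019] C. Ikenmeyer, U. Kandasamy, STOC 2020 = arXiv:1911.03990: Thm. 9.1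
  (TeX L735–750), Prop. 10.1 (L850–853), §9 (L800–836), proof of Thm. 4.2 (L1147–1154), §7 (`P_m`),
  Lemma 8.1 / eq. (8.2).
* W. Fulton, *Young Tableaux*, LMS Student Texts 35 (1997), §8.1–8.2. [FultonYoungTableaux1997]
-/

noncomputable section

open scoped BigOperators

namespace Literature.Computability.AlgebraicComplexity

namespace IK2020

open Finset
open _root_.Literature.NumberTheory.DiophantineGeometry

/-! ### §1 The orbit function of a word is the matrix coefficient of its symmetrised Young tensor -/

section OrbitFunction

variable {m n : ℕ} (lam : Nat.Partition n) (hlam : lam.parts.card ≤ m)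

open scoped Classical in
/-- **`⟨e_r, s · h_x⟩ = |R_λ| · f^{S_x}(s)`**: for `s ∈ SL_m(ℂ)` and a word `x`, the `e_{rowWord}`-
coordinate of `s · h_x`, `h_x = ∑_{π ∈ 𝔖_m} P_π · (c_λ e_x)`, is `|R_λ| · ∑_π γ(s, T_{π∘x})` — IK's orbit
function `g ↦ γ(g P_m S)` (§7, §13) of the tableau `S = T_x`, up to `|R_λ|` (M1 termwise, with
`P_π c_λ e_x = c_λ e_{π∘x}`). [cite: IkenmeyerKandasamy2019, Thm. 9.1 and §13 (proof of Thm. 4.2)] -/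
theorem repr_toGL_symYoung_rowWord (s : Matrix.SpecialLinearGroup (Fin m) ℂ) (x : Fin n → Fin m) :
    (tensorBasis ℂ (Fin m) n).repr (glTensorRep (Fin m) ℂ n (Matrix.SpecialLinearGroup.toGL s)
        (∑ π : Equiv.Perm (Fin m), glTensorRep (Fin m) ℂ n (permGL ℂ π)
          ((permTensorRep ℂ (Fin m → ℂ) n).asAlgebraHom (youngSymmetrizer ℂ lam)
            (tensorBasis ℂ (Fin m) n x)))) (rowWord lam hlam) =
      (Fintype.card (rowStabilizer lam) : ℂ) *
        ∑ π : Equiv.Perm (Fin m), gammaProd ℂ (s : Matrix (Fin m) (Fin m) ℂ) (colHeight lam)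
          (fun c => (colHeight_le_card lam c).trans hlam) (wordTableau lam (π ∘ x)).entry := by
  rw [map_sum, map_sum, Finsupp.coe_finsetSum, Finset.sum_apply, Finset.mul_sum]
  refine Finset.sum_congr rfl fun π _ => ?_
  rw [glTensorRep_young lam (permGL ℂ π), glTensorRep_permGL_tensorBasis,
    repr_glTensorRep_youngSymmetrizer_tensorBasis_rowWord lam hlam]
  rfl

/-- **From independent tensors to independent orbit functions** (M2): if the symmetrised Young
tensors `h_{x_j}` of finitely many words are linearly independent in `(ℂ^m)^{⊗n}`, then so are the
orbit functions `s ↦ ∑_π γ(s, T_{π ∘ x_j})` on `SL_m(ℂ)` — a relation `∑ a_j f_j = 0` makes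
`∑ a_j h_{x_j} ∈ {λ}` invisible to every `⟨e_r, s · –⟩`, hence zero
(`eq_zero_of_forall_sl_repr_rowWord_eq_zero`). IK TeX L1150–1154.
[cite: IkenmeyerKandasamy2019, Thm. 4.2 (proof, §13), TeX L1147–1154] -/
theorem linearIndependent_orbitFun_of_symYoung (hm : 0 < m) {ι : Type*} [Fintype ι]
    (x : ι → Fin n → Fin m)
    (hli : LinearIndependent ℂ fun j => ∑ π : Equiv.Perm (Fin m),
      glTensorRep (Fin m) ℂ n (permGL ℂ π)
        ((permTensorRep ℂ (Fin m → ℂ) n).asAlgebraHom (youngSymmetrizer ℂ lam)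
          (tensorBasis ℂ (Fin m) n (x j)))) :
    LinearIndependent ℂ fun j (s : Matrix.SpecialLinearGroup (Fin m) ℂ) =>
      ∑ π : Equiv.Perm (Fin m), gammaProd ℂ (s : Matrix (Fin m) (Fin m) ℂ) (colHeight lam)
        (fun c => (colHeight_le_card lam c).trans hlam) (wordTableau lam (π ∘ x j)).entry := by
  classical
  rw [Fintype.linearIndependent_iff] at hli ⊢
  intro a ha j
  -- the vector `v = ∑ a_j h_{x_j}` of the Weyl module
  set H : ι → TensorPower ℂ n (Fin m → ℂ) := fun j => ∑ π : Equiv.Perm (Fin m),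
    glTensorRep (Fin m) ℂ n (permGL ℂ π)
      ((permTensorRep ℂ (Fin m → ℂ) n).asAlgebraHom (youngSymmetrizer ℂ lam)
        (tensorBasis ℂ (Fin m) n (x j))) with hH
  have hvmem : ∑ j, a j • H j ∈ weylModule ℂ (Fin m) lam :=
    Submodule.sum_mem _ fun j _ => Submodule.smul_mem _ _ (symYoung_mem_weylModule lam (x j))
  have hv0 : ∑ j, a j • H j = 0 := by
    refine eq_zero_of_forall_sl_repr_rowWord_eq_zero hm lam hlam hvmem fun s => ?_
    have hs := congr_fun ha s
    simp only [Finset.sum_apply, Pi.smul_apply, smul_eq_mul, Pi.zero_apply] at hs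
    rw [map_sum, map_sum, Finsupp.coe_finsetSum, Finset.sum_apply]
    have hterm : ∀ j, (tensorBasis ℂ (Fin m) n).repr
        (glTensorRep (Fin m) ℂ n (Matrix.SpecialLinearGroup.toGL s) (a j • H j)) (rowWord lam hlam) =
        (Fintype.card (rowStabilizer lam) : ℂ) * (a j *
          ∑ π : Equiv.Perm (Fin m), gammaProd ℂ (s : Matrix (Fin m) (Fin m) ℂ) (colHeight lam)
            (fun c => (colHeight_le_card lam c).trans hlam) (wordTableau lam (π ∘ x j)).entry) := by
      intro j
      rw [map_smul, map_smul, Finsupp.smul_apply, smul_eq_mul, hH, repr_toGL_symYoung_rowWord]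
      ring
    simp only [hterm, ← Finset.mul_sum, hs, mul_zero]
  exact hli a hv0 j

end OrbitFunction

/-! ### §2 Extraction of `b(λ,ϱ,D,d)` independent symmetrised Young tensors of content `D·ϱ` -/

section Extraction

variable {m d D : ℕ}

/-- Normalising a word of the content class `𝔖_m·(D·ϱ)` to content exactly `D·ϱ` by a letter
permutation (`content(π ∘ x)_i = content(x)_{π⁻¹ i}`). [cite: IkenmeyerKandasamy2019, Thm. 9.1] -/
theorem exists_perm_comp_wordContent_eq {n : ℕ} (ϱ : Nat.Partition d) {x : Fin n → Fin m}
    (hx : ∃ π : Equiv.Perm (Fin m), (fun i => (wordContent x i : ℤ)) =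
      fun i => (D : ℤ) * Weight.ofPartition m ϱ (π i)) :
    ∃ π : Equiv.Perm (Fin m), ∀ i, (wordContent (π ∘ x) i : ℤ) = (D : ℤ) * Weight.ofPartition m ϱ i := by
  obtain ⟨π, hπ⟩ := hx
  refine ⟨π, fun i => ?_⟩
  rw [wordContent_perm_comp]
  have := congr_fun hπ (π.symm i)
  simp only [Equiv.apply_symm_apply] at this
  exact this

/-- **Extraction**: for IK's data (`3 ≤ D ≤ m`, `λ ⊢ dD` with at most `m` parts, `ϱ ⊢_m d`) there are
`b(λ,ϱ,D,d)` words of content exactly `D·ϱ` whose symmetrised Young tensors `h_x = ∑_π P_π c_λ e_x`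
are linearly independent (a basis of the `b`-dimensional span of M3, chosen among the spanning
vectors and normalised inside the class). [cite: IkenmeyerKandasamy2019, Thm. 9.1 and Prop. 10.1] -/
theorem exists_words_linearIndependent_symYoung (hD : 3 ≤ D) (hDm : D ≤ m)
    (lam : Nat.Partition (d * D)) (hlam : lam.parts.card ≤ m) (ϱ : Nat.Partition d)
    (hϱ : ϱ.parts.card ≤ m) :
    ∃ x : Fin (bCoeff ℂ m D d lam ϱ) → Fin (d * D) → Fin m,
      (∀ i a, (wordContent (x i) a : ℤ) = (D : ℤ) * Weight.ofPartition m ϱ a) ∧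
      LinearIndependent ℂ fun i => ∑ π : Equiv.Perm (Fin m),
        glTensorRep (Fin m) ℂ (d * D) (permGL ℂ π)
          ((permTensorRep ℂ (Fin m → ℂ) (d * D)).asAlgebraHom (youngSymmetrizer ℂ lam)
            (tensorBasis ℂ (Fin m) (d * D) (x i))) := by
  classical
  haveI : Module.Finite ℂ (TensorPower ℂ (d * D) (Fin m → ℂ)) :=
    Module.Finite.of_basis (tensorBasis ℂ (Fin m) (d * D))
  set H : (Fin (d * D) → Fin m) → TensorPower ℂ (d * D) (Fin m → ℂ) := fun x =>
    ∑ π : Equiv.Perm (Fin m), glTensorRep (Fin m) ℂ (d * D) (permGL ℂ π)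
      ((permTensorRep ℂ (Fin m → ℂ) (d * D)).asAlgebraHom (youngSymmetrizer ℂ lam)
        (tensorBasis ℂ (Fin m) (d * D) x)) with hHdef
  set X : Set (Fin (d * D) → Fin m) := {x | ∃ π : Equiv.Perm (Fin m),
    (fun i => (wordContent x i : ℤ)) = fun i => (D : ℤ) * Weight.ofPartition m ϱ (π i)} with hXdef
  obtain ⟨B, hBsub, hBspan, hBli⟩ := exists_linearIndependent ℂ (H '' X)
  haveI : Fintype B := (hBli.setFinite).fintype
  have hcard : Fintype.card B = bCoeff ℂ m D d lam ϱ := by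
    rw [← Set.toFinset_card, ← finrank_span_set_eq_card (R := ℂ) (s := B) hBli, hBspan]
    exact finrank_span_symYoung_eq_bCoeff hD hDm lam hlam ϱ hϱ
  let e : Fin (bCoeff ℂ m D d lam ϱ) ≃ B := (Fintype.equivFinOfCardEq hcard).symm
  -- preimage words, normalised to content exactly `D·ϱ`
  have hpre : ∀ v : B, ∃ x : Fin (d * D) → Fin m,
      (∀ a, (wordContent x a : ℤ) = (D : ℤ) * Weight.ofPartition m ϱ a) ∧ H x = (v : _) := by
    intro v
    obtain ⟨x, hxX, hxv⟩ := (Set.mem_image _ _ _).mp (hBsub v.2)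
    obtain ⟨π, hπ⟩ := exists_perm_comp_wordContent_eq ϱ hxX
    refine ⟨π ∘ x, hπ, ?_⟩
    rw [← hxv, hHdef]
    exact symYoung_comp_perm lam π x
  choose xs hxs_content hxs_eq using hpre
  refine ⟨fun i => xs (e i), fun i => hxs_content (e i), ?_⟩
  have hfun : (fun i => H (xs (e i))) = (fun v : B => (v : TensorPower ℂ (d * D) (Fin m → ℂ))) ∘ e :=
    funext fun i => hxs_eq (e i)
  show LinearIndependent ℂ fun i => H (xs (e i))
  rw [hfun]
  exact hBli.comp e e.injective

/-- The symmetrised Young tensors of content `D·ϱ` lie in `{λ}_ϱ` (viewed in the Weyl module):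
`h_x ∈ span (h '' class) = ({λ}_ϱ)^{𝔖_m} ⊆ {λ}_ϱ` (M3). [cite: IkenmeyerKandasamy2019, Thm. 9.1] -/
theorem exists_mem_contentSubspace_coe_eq_symYoung {n : ℕ} (lam : Nat.Partition n) (ϱ : Nat.Partition d)
    {x : Fin n → Fin m} (hx : ∀ a, (wordContent x a : ℤ) = (D : ℤ) * Weight.ofPartition m ϱ a) :
    ∃ w : weylModule ℂ (Fin m) lam, w ∈ contentSubspace ℂ m D lam ϱ ∧
      (w : TensorPower ℂ n (Fin m → ℂ)) = ∑ π : Equiv.Perm (Fin m),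
        glTensorRep (Fin m) ℂ n (permGL ℂ π)
          ((permTensorRep ℂ (Fin m → ℂ) n).asAlgebraHom (youngSymmetrizer ℂ lam)
            (tensorBasis ℂ (Fin m) n x)) := by
  classical
  have hxX : x ∈ {x : Fin n → Fin m | ∃ π : Equiv.Perm (Fin m),
      (fun i => (wordContent x i : ℤ)) = fun i => (D : ℤ) * Weight.ofPartition m ϱ (π i)} :=
    ⟨1, funext fun i => by rw [hx i]; rfl⟩
  have hmem : (∑ π : Equiv.Perm (Fin m), glTensorRep (Fin m) ℂ n (permGL ℂ π)
      ((permTensorRep ℂ (Fin m → ℂ) n).asAlgebraHom (youngSymmetrizer ℂ lam)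
        (tensorBasis ℂ (Fin m) n x))) ∈ Submodule.span ℂ
      ((fun x : Fin n → Fin m => ∑ π : Equiv.Perm (Fin m), glTensorRep (Fin m) ℂ n (permGL ℂ π)
        ((permTensorRep ℂ (Fin m → ℂ) n).asAlgebraHom (youngSymmetrizer ℂ lam)
          (tensorBasis ℂ (Fin m) n x))) ''
        {x | ∃ π : Equiv.Perm (Fin m), (fun i => (wordContent x i : ℤ)) =
          fun i => (D : ℤ) * Weight.ofPartition m ϱ (π i)}) :=
    Submodule.subset_span (Set.mem_image_of_mem _ hxX)
  rw [span_symYoung_eq_map_permFixed_contentSubspace lam D ϱ, Submodule.mem_map] at hmem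
  obtain ⟨w, hw, hwx⟩ := hmem
  refine ⟨w, ?_, hwx⟩
  unfold permFixed at hw
  exact (Submodule.mem_inf.mp hw).1

end Extraction

/-! ### §3 The discharge -/

/-- **Ikenmeyer–Kandasamy 2020, Thm. 9.1 with Prop. 10.1 in the form consumed by Thm. 4.2 — the
named fact `IK2020_thm_9_1_orbitFunctions` HOLDS.** For `3 ≤ D ≤ m`, `λ ⊢ dD` with at most `m`
parts and `Ξ ⊆ {ϱ ⊢_m d}` there are regular tableaux `S_{ϱ,i}` (`ϱ ∈ Ξ`, `i < b(λ,ϱ,D,d)`) of shape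
`λ` and content `D·ϱ` whose orbit functions `g ↦ ∑_{π ∈ 𝔖_m} γ(g (πS_{ϱ,i}))` are linearly
independent on `SL_m(ℂ)`. Proof = §1–§2 + the direct sum `⊕_ϱ {λ}_ϱ`
(`contentSubspace_independent`); the tableaux are `S_{ϱ,i} = T_{x_{ϱ,i}}` for the extracted words.
[cite: IkenmeyerKandasamy2019, Thm. 9.1 and Prop. 10.1 (as used in the proof of Thm. 4.2, §13)] -/
theorem IK2020_thm_9_1_orbitFunctions_holds' :
    ∀ (m D d : ℕ), 3 ≤ D → D ≤ m → ∀ (lam : Nat.Partition (d * D)), lam.parts.card ≤ m →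
    ∀ (Ξ : Finset (Nat.Partition d)), (∀ ρ ∈ Ξ, ρ.parts.card ≤ m) →
      ∃ (S : (ρ : Ξ) → Fin (bCoeff ℂ m D d lam ρ) → ColTableau (Fin m))
        (hS : ∀ ρ i c, (S ρ i).h c ≤ m),
        (∀ ρ i, (S ρ i).IsShape m (d * D) ∧ (S ρ i).IsRegular ∧
          (∀ r : Fin m,
            (Finset.univ.filter fun c : Fin (S ρ i).C => (r : ℕ) < (S ρ i).h c).card =
              lam.sortedParts.getD r 0) ∧
          (∀ a : Fin m,
            (S ρ i).count a = D * (ρ : Nat.Partition d).sortedParts.getD a 0)) ∧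
        LinearIndependent ℂ fun (x : Σ ρ : Ξ, Fin (bCoeff ℂ m D d lam ρ))
            (g : Matrix.SpecialLinearGroup (Fin m) ℂ) =>
          ∑ π : Equiv.Perm (Fin m),
            gammaProd ℂ (g : Matrix (Fin m) (Fin m) ℂ) (S x.1 x.2).h (hS x.1 x.2)
              fun c r => π ((S x.1 x.2).entry c r) := by
  intro m D d hD hDm lam hlam Ξ hΞ
  classical
  have hm : 0 < m := by omega
  have hD0 : D ≠ 0 := by omega
  -- the symmetrised Young tensor `h_y`, as an opaque function with its defining equation
  obtain ⟨H, hH⟩ : ∃ H : (Fin (d * D) → Fin m) → TensorPower ℂ (d * D) (Fin m → ℂ), ∀ y, H y =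
      ∑ π : Equiv.Perm (Fin m), glTensorRep (Fin m) ℂ (d * D) (permGL ℂ π)
        ((permTensorRep ℂ (Fin m → ℂ) (d * D)).asAlgebraHom (youngSymmetrizer ℂ lam)
          (tensorBasis ℂ (Fin m) (d * D) y)) := ⟨_, fun _ => rfl⟩
  -- §2: the words, class by class
  have hex := fun ρ : Ξ => exists_words_linearIndependent_symYoung hD hDm lam hlam
    (ρ : Nat.Partition d) (hΞ _ ρ.2)
  choose x hxc hxli using hex
  have hxli' : ∀ ρ : Ξ, LinearIndependent ℂ fun i => H (x ρ i) := by
    intro ρ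
    simpa only [← hH] using hxli ρ
  -- the class components, as vectors of `{λ}_ϱ`
  have hw : ∀ (ρ : Ξ) (i : Fin (bCoeff ℂ m D d lam ρ)), ∃ w : weylModule ℂ (Fin m) lam,
      w ∈ contentSubspace ℂ m D lam (ρ : Nat.Partition d) ∧
        (w : TensorPower ℂ (d * D) (Fin m → ℂ)) = H (x ρ i) := by
    intro ρ i
    rw [hH]
    exact exists_mem_contentSubspace_coe_eq_symYoung (D := D) lam (ρ : Nat.Partition d) (hxc ρ i)
  choose w hwmem hwcoe using hw
  -- joint independence of the `h`'s over the Σ-index (direct sum over `ϱ`)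
  have hjoint : LinearIndependent ℂ
      fun j : (Σ ρ : Ξ, Fin (bCoeff ℂ m D d lam ρ)) => H (x j.1 j.2) := by
    rw [Fintype.linearIndependent_iff]
    intro a ha
    let v : Nat.Partition d → weylModule ℂ (Fin m) lam := fun ϱ =>
      if hϱ : ϱ ∈ Ξ then ∑ i, a ⟨⟨ϱ, hϱ⟩, i⟩ • w ⟨ϱ, hϱ⟩ i else 0
    have hvΞ : ∀ ρ : Ξ, v ρ = ∑ i, a ⟨ρ, i⟩ • w ρ i := by
      intro ρ
      simp only [v, dif_pos ρ.2]
    have hvmem : ∀ ϱ ∈ (Finset.univ : Finset (Nat.Partition d)).filter (fun ϱ => ϱ.parts.card ≤ m),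
        v ϱ ∈ contentSubspace ℂ m D lam ϱ := by
      intro ϱ _
      by_cases hϱ : ϱ ∈ Ξ
      · rw [hvΞ ⟨ϱ, hϱ⟩]
        exact Submodule.sum_mem _ fun i _ => Submodule.smul_mem _ _ (hwmem _ i)
      · simp only [v, dif_neg hϱ]
        exact Submodule.zero_mem _
    have ha' : ∑ ρ : Ξ, ∑ i, a ⟨ρ, i⟩ • H (x ρ i) = 0 := by
      have h := ha
      rw [Fintype.sum_sigma] at h
      exact h
    have hvsum : ∑ ϱ ∈ (Finset.univ : Finset (Nat.Partition d)).filter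
        (fun ϱ => ϱ.parts.card ≤ m), v ϱ = 0 := by
      have hsub : Ξ ⊆ (Finset.univ : Finset (Nat.Partition d)).filter
          (fun ϱ => ϱ.parts.card ≤ m) :=
        fun ϱ hϱ => Finset.mem_filter.mpr ⟨Finset.mem_univ _, hΞ ϱ hϱ⟩
      rw [← Finset.sum_subset hsub (fun ϱ _ hϱ => by simp only [v, dif_neg hϱ]),
        ← Finset.sum_coe_sort Ξ]
      rw [← Submodule.coe_eq_zero, Submodule.coe_sum]
      simp only [hvΞ, Submodule.coe_sum, Submodule.coe_smul, hwcoe]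
      exact ha'
    have hv0 := contentSubspace_independent (k := ℂ) hD0 lam v hvmem hvsum
    rintro ⟨ρ, i⟩
    have hρ0 : v ρ = 0 := hv0 ρ (Finset.mem_filter.mpr ⟨Finset.mem_univ _, hΞ _ ρ.2⟩)
    have hcls : ∑ i, a ⟨ρ, i⟩ • H (x ρ i) = 0 := by
      rw [hvΞ ρ, ← Submodule.coe_eq_zero, Submodule.coe_sum] at hρ0
      simpa only [Submodule.coe_smul, hwcoe] using hρ0
    exact (Fintype.linearIndependent_iff.mp (hxli' ρ)) (fun i => a ⟨ρ, i⟩) hcls i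
  -- the tableaux `S_{ϱ,i} = T_{x_{ϱ,i}}`
  refine ⟨fun ρ i => wordTableau lam (x ρ i), fun ρ i c => (colHeight_le_card lam c).trans hlam,
    fun ρ i => ⟨wordTableau_isShape lam hlam _, ?_, fun r => card_filter_lt_wordTableau_h lam _ r,
      fun a => ?_⟩, ?_⟩
  · -- regular: the word is column-strict because `h_x ≠ 0`
    rw [isRegular_wordTableau_iff]
    by_contra hcs
    apply (hxli' ρ).ne_zero i
    rw [hH]
    refine Finset.sum_eq_zero fun π _ => ?_
    rw [young_tensorBasis_eq_zero_of_not_isColStrict lam (fun h => hcs fun p q h1 h2 => h h1 h2),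
      map_zero]
  · -- content `D·ϱ`
    rw [count_wordTableau]
    have h1 := hxc ρ i a
    rw [Weight.ofPartition_apply] at h1
    exact_mod_cast h1
  · -- linear independence of the orbit functions on `SL_m`
    have hjoint' : LinearIndependent ℂ fun j : (Σ ρ : Ξ, Fin (bCoeff ℂ m D d lam ρ)) =>
        ∑ π : Equiv.Perm (Fin m), glTensorRep (Fin m) ℂ (d * D) (permGL ℂ π)
          ((permTensorRep ℂ (Fin m → ℂ) (d * D)).asAlgebraHom (youngSymmetrizer ℂ lam)
            (tensorBasis ℂ (Fin m) (d * D) (x j.1 j.2))) := by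
      simpa only [hH] using hjoint
    exact linearIndependent_orbitFun_of_symYoung lam hlam hm
      (fun j : (Σ ρ : Ξ, Fin (bCoeff ℂ m D d lam ρ)) => x j.1 j.2) hjoint'

/-- **The named fact `IK2020_thm_9_1_orbitFunctions` holds.**
[cite: IkenmeyerKandasamy2019, Thm. 9.1 and Prop. 10.1 (as used in the proof of Thm. 4.2, §13)] -/
theorem IK2020_thm_9_1_orbitFunctions_holds : IK2020_thm_9_1_orbitFunctions :=
  IK2020_thm_9_1_orbitFunctions_holds'

end IK2020

/-- Root-namespace alias of the discharge. [cite: IkenmeyerKandasamy2019, Thm. 9.1 and Prop. 10.1] -/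
theorem IK2020_thm_9_1_orbitFunctions_holds : IK2020_thm_9_1_orbitFunctions :=
  IK2020.IK2020_thm_9_1_orbitFunctions_holds'

/-! ### §4 Consequences: the Main Technical Theorem 4.2 and Lemma 5.2 are theorems of the tree -/

/-- **Ikenmeyer–Kandasamy 2020, Thm. 4.2 (Main Technical Theorem) — the named fact `IK2020_thm_4_2`
HOLDS** (TeX L390–402: "`mult_{(λ+(m × e_Ξ D))^*} ℂ[\overline{Gp}] ≥ ∑_{ϱ ∈ Ξ} b(λ,ϱ,D,d)`" for
`p = x₁^D + ⋯ + x_m^D`, `3 ≤ D ≤ m`, IK's binomial condition for odd `D`): by the §13 assembly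
`IK2020_thm_4_2_of_orbitFunctions` (val-lit-t02, `IK2020Thm42OfOrbitFunctions.lean`: Tableau
Lifting `IK2020_thm_13_1_holds` + B1/B2/B3/B4) applied to `IK2020_thm_9_1_orbitFunctions_holds`.
[cite: IkenmeyerKandasamy2019, Thm. 4.2] -/
theorem IK2020_thm_4_2_holds : IK2020_thm_4_2 :=
  IK2020_thm_4_2_of_orbitFunctions IK2020_thm_9_1_orbitFunctions_holds

/-- **Ikenmeyer–Kandasamy 2020, Lemma 5.2 — the named fact `IK2020_lemma_5_2` HOLDS** (TeX
L513–521), through `IK2020_lemma_5_2_of_thm_4_2` (val-lit-t01, `IK2020Lemma52OfThm42.lean`: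
Thm. 4.2 + Prop. 10.1 + Lemma 5.1's count) and `IK2020_thm_4_2_holds`.
[cite: IkenmeyerKandasamy2019, Lemma 5.2] -/
theorem IK2020_lemma_5_2_holds : IK2020_lemma_5_2 :=
  IK2020_lemma_5_2_of_thm_4_2 IK2020_thm_4_2_holds

end Literature.Computability.AlgebraicComplexity

end
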